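import Summits.ABC.ABC.Theorems.TwistAmplificationMazurKaneLawRecordDEDefs
import Summits.ABC.ABC.Theorems.TwistAmplificationMazurKaneLawKitPlateau

/-!
# Crux `TwistAmplification.MazurKaneLaw` (stmt-ABC-2757), line `critical-kloosterman-powerful-moduli`: the LP of the kit with the
# DE family has value `(2 + s₀)/4` on the plateau `16/9 ≤ s₀ ≤ 2` (a BARRIER theorem for the record pipeline v3)

Lead c4, stub `stub_kitDE_lp_value_plateau`. The record pipeline v3 certifies the exponent `(2 + s₀)/4` for
`#{abc triples, c ≤ N, rad ≤ c^{s₀}}`, `16/9 ≤ s₀ ≤ 2`, from a proof of the pure-real linear programme `LpCertDE 3 4 s₀ ((2 + s₀)/4)`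
(`…RecordDEDefs.lean`, `…RecordLPDE*.lean`). This file proves the converse BARRIER: for every slack coefficient `K`, every number
`J ≥ 3` of explicit levels and every `s₀ ∈ [16/9, 2]`, NO certificate `LpCertDE K J s₀ Vc` with `Vc < (2 + s₀)/4` exists, because the
whole hypothesis telescope (structure rows, radical budget, trivial / determinant / Fourier / geometry-of-numbers / square-root-lattice
families AND the three DE families, for ALL index finsets) is satisfied by the explicit exponent datum
`a = (x, x, z, 0, …)`, `b = (y, x, 0, …)`, `c = (x, y, 0, …)`, `A = 2x + z`, `B = C = x + y`, `da = dc = σ = 0`, `db = w`, `D = (2 + s₀)/4`,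
where `x = (3 s₀ - 4)/6`, `y = (10 - 3 s₀)/12`, `z = (2 - s₀)/2`, `w = 3 (2 - s₀)/4` (so `A + B + C = s₀`; the three slope rows, the
determinant rows, one geometry-of-numbers row, two square-root rows and one DE row hold with equality). It is the exact analogue of
`kit_lp_value_one_at_sixteen_ninths` (`…KitPlateau.lean`, the kit WITHOUT the DE rows at `s₀ = 16/9`), whose helper lemmas are reused;
the only new bookkeeping is `kitDEPlateau_sum_support_three`, the exact evaluation of a finset sum of a profile supported on the
indices `0, 1, 2`, used to evaluate the DE rows (which contain the level-set sums with both signs).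
-/

-- `Summit.<Summit>.<Problem>` is the mandated summit-side namespace; the duplicate `ABC.ABC` is deliberate (single-conjunct summit).
set_option linter.dupNamespace false

namespace Summit.ABC.ABC.Theorems.MazurKaneLaw

/-- A profile on `Fin J` vanishing at every index `≥ 3`: its sum over an arbitrary index finset `Q` is read off from the memberships
in `Q` of the three indices `i0 = 0`, `i1 = 1`, `i2 = 2`. -/
theorem kitDEPlateau_sum_support_three {J : ℕ} {i0 i1 i2 : Fin J} (hi0 : (i0 : ℕ) = 0) (hi1 : (i1 : ℕ) = 1)
    (hi2 : (i2 : ℕ) = 2) (f : Fin J → ℝ) (hf : ∀ k : Fin J, 3 ≤ (k : ℕ) → f k = 0) (Q : Finset (Fin J)) :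
    ∑ j ∈ Q, f j = (if i0 ∈ Q then f i0 else 0) + (if i1 ∈ Q then f i1 else 0) + (if i2 ∈ Q then f i2 else 0) := by
  have hpt : ∀ j : Fin J,
      f j = (if j = i0 then f i0 else 0) + (if j = i1 then f i1 else 0) + (if j = i2 then f i2 else 0) := by
    intro j
    have e0 : j = i0 ↔ (j : ℕ) = 0 := by rw [Fin.ext_iff, hi0]
    have e1 : j = i1 ↔ (j : ℕ) = 1 := by rw [Fin.ext_iff, hi1]
    have e2 : j = i2 ↔ (j : ℕ) = 2 := by rw [Fin.ext_iff, hi2]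
    by_cases h0 : (j : ℕ) = 0
    · have n1 : ¬ j = i1 := fun h => by rw [e1] at h; omega
      have n2 : ¬ j = i2 := fun h => by rw [e2] at h; omega
      rw [if_pos (e0.2 h0), if_neg n1, if_neg n2, e0.2 h0, add_zero, add_zero]
    by_cases h1 : (j : ℕ) = 1
    · have n0 : ¬ j = i0 := fun h => by rw [e0] at h; omega
      have n2 : ¬ j = i2 := fun h => by rw [e2] at h; omega
      rw [if_neg n0, if_pos (e1.2 h1), if_neg n2, e1.2 h1, zero_add, add_zero]
    by_cases h2 : (j : ℕ) = 2
    · have n0 : ¬ j = i0 := fun h => by rw [e0] at h; omega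
      have n1 : ¬ j = i1 := fun h => by rw [e1] at h; omega
      rw [if_neg n0, if_neg n1, if_pos (e2.2 h2), e2.2 h2, zero_add, zero_add]
    have n0 : ¬ j = i0 := fun h => by rw [e0] at h; omega
    have n1 : ¬ j = i1 := fun h => by rw [e1] at h; omega
    have n2 : ¬ j = i2 := fun h => by rw [e2] at h; omega
    rw [if_neg n0, if_neg n1, if_neg n2, hf j (by omega), add_zero, add_zero]
  rw [Finset.sum_congr rfl fun j _ => hpt j, Finset.sum_add_distrib, Finset.sum_add_distrib,
    Finset.sum_ite_eq', Finset.sum_ite_eq', Finset.sum_ite_eq']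

/-- **The LP of the kit with the DE family has value `(2 + s₀)/4` on the plateau** (registered stub `stub_kitDE_lp_value_plateau` of
crux stmt-ABC-2757, line `critical-kloosterman-powerful-moduli`; a barrier theorem for the record pipeline v3): for every `K`, every
`J ≥ 3` and every `16/9 ≤ s₀ ≤ 2`, a certificate `LpCertDE K J s₀ Vc` forces `(2 + s₀)/4 ≤ Vc`. Witness: `a = (x, x, z, 0, …)`,
`b = (y, x, 0, …)`, `c = (x, y, 0, …)`, `x = (3s₀-4)/6`, `y = (10-3s₀)/12`, `z = (2-s₀)/2`, deficits `da = dc = 0`, `db = 3(2-s₀)/4`,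
slack `0`, `D = (2 + s₀)/4`. -/
theorem stub_kitDE_lp_value_plateau : ∀ (K : ℝ) (J : ℕ), 3 ≤ J → ∀ s₀ : ℝ, (16 / 9 : ℝ) ≤ s₀ → s₀ ≤ 2 → ∀ Vc : ℝ, Summit.ABC.ABC.Theorems.MazurKaneLaw.Toolkit.LpCertDE K J s₀ Vc → (2 + s₀) / 4 ≤ Vc := by
  intro K J hJ s₀ hs1 hs2 Vc h
  unfold Summit.ABC.ABC.Theorems.MazurKaneLaw.Toolkit.LpCertDE at h
  -- the parameters of the witness
  obtain ⟨x, hx⟩ : ∃ x : ℝ, x = (3 * s₀ - 4) / 6 := ⟨_, rfl⟩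
  obtain ⟨y, hy⟩ : ∃ y : ℝ, y = (10 - 3 * s₀) / 12 := ⟨_, rfl⟩
  obtain ⟨z, hz⟩ : ∃ z : ℝ, z = (2 - s₀) / 2 := ⟨_, rfl⟩
  obtain ⟨w, hw⟩ : ∃ w : ℝ, w = 3 * (2 - s₀) / 4 := ⟨_, rfl⟩
  have hx1 : 2 / 9 ≤ x := by linarith only [hx, hs1]
  have hy1 : 1 / 3 ≤ y := by linarith only [hy, hs2]
  have hxy : x ≤ y := by linarith only [hx, hy, hs2]
  have hz0 : 0 ≤ z := by linarith only [hz, hs2]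
  have hz1 : z ≤ 1 / 9 := by linarith only [hz, hs1]
  have hw0 : 0 ≤ w := by linarith only [hw, hs2]
  have hw1 : w ≤ 1 := by linarith only [hw, hs1]
  -- the explicit witness `a = (x, x, z, 0, …)`, `b = (y, x, 0, …)`, `c = (x, y, 0, …)`
  obtain ⟨a, ha⟩ : ∃ a : Fin J → ℝ, ∀ k, a k =
      (if (k : ℕ) = 0 then x else if (k : ℕ) = 1 then x else if (k : ℕ) = 2 then z else 0 : ℝ) :=
    ⟨_, fun _ => rfl⟩
  obtain ⟨b, hb⟩ : ∃ b : Fin J → ℝ, ∀ k, b k =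
      (if (k : ℕ) = 0 then y else if (k : ℕ) = 1 then x else if (k : ℕ) = 2 then 0 else 0 : ℝ) :=
    ⟨_, fun _ => rfl⟩
  obtain ⟨c, hc⟩ : ∃ c : Fin J → ℝ, ∀ k, c k =
      (if (k : ℕ) = 0 then x else if (k : ℕ) = 1 then y else if (k : ℕ) = 2 then 0 else 0 : ℝ) :=
    ⟨_, fun _ => rfl⟩
  obtain ⟨i0, hi0⟩ : ∃ i : Fin J, (i : ℕ) = 0 := ⟨⟨0, by omega⟩, rfl⟩
  obtain ⟨i1, hi1⟩ : ∃ i : Fin J, (i : ℕ) = 1 := ⟨⟨1, by omega⟩, rfl⟩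
  obtain ⟨i2, hi2⟩ : ∃ i : Fin J, (i : ℕ) = 2 := ⟨⟨2, by omega⟩, rfl⟩
  have h12 : i1 ≠ i2 := fun he => by
    have hv := congrArg Fin.val he
    omega
  have n10 : (i1 : ℕ) ≠ 0 := by omega
  have n20 : (i2 : ℕ) ≠ 0 := by omega
  have n21 : (i2 : ℕ) ≠ 1 := by omega
  -- nonnegativity, vanishing beyond the index `2`, special values and pointwise bounds
  have ha0 : ∀ k, 0 ≤ a k := fun k => by rw [ha]; split_ifs <;> linarith only [hx1, hz0]
  have hb0 : ∀ k, 0 ≤ b k := fun k => by rw [hb]; split_ifs <;> linarith only [hx1, hy1]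
  have hc0 : ∀ k, 0 ≤ c k := fun k => by rw [hc]; split_ifs <;> linarith only [hx1, hy1]
  have ha3 : ∀ k : Fin J, 3 ≤ (k : ℕ) → a k = 0 := fun k hk => by
    have n0 : (k : ℕ) ≠ 0 := by omega
    have n1 : (k : ℕ) ≠ 1 := by omega
    have n2 : (k : ℕ) ≠ 2 := by omega
    rw [ha, if_neg n0, if_neg n1, if_neg n2]
  have hb3 : ∀ k : Fin J, 3 ≤ (k : ℕ) → b k = 0 := fun k hk => by
    have n0 : (k : ℕ) ≠ 0 := by omega
    have n1 : (k : ℕ) ≠ 1 := by omega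
    have n2 : (k : ℕ) ≠ 2 := by omega
    rw [hb, if_neg n0, if_neg n1, if_neg n2]
  have hc3 : ∀ k : Fin J, 3 ≤ (k : ℕ) → c k = 0 := fun k hk => by
    have n0 : (k : ℕ) ≠ 0 := by omega
    have n1 : (k : ℕ) ≠ 1 := by omega
    have n2 : (k : ℕ) ≠ 2 := by omega
    rw [hc, if_neg n0, if_neg n1, if_neg n2]
  have hai0 : a i0 = x := by rw [ha, if_pos hi0]
  have hbi0 : b i0 = y := by rw [hb, if_pos hi0]
  have hci0 : c i0 = x := by rw [hc, if_pos hi0]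
  have hai1 : a i1 = x := by rw [ha, if_neg n10, if_pos hi1]
  have hbi1 : b i1 = x := by rw [hb, if_neg n10, if_pos hi1]
  have hci1 : c i1 = y := by rw [hc, if_neg n10, if_pos hi1]
  have hai2 : a i2 = z := by rw [ha, if_neg n20, if_neg n21, if_pos hi2]
  have hbi2 : b i2 = 0 := by rw [hb, if_neg n20, if_neg n21, if_pos hi2]
  have hci2 : c i2 = 0 := by rw [hc, if_neg n20, if_neg n21, if_pos hi2]
  have habc : ∀ k, a k + b k + c k ≤ 2 * x + y := fun k => by
    rw [ha, hb, hc]; split_ifs <;> linarith only [hx1, hy1, hz1]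
  have hbc : ∀ k, b k + c k ≤ x + y := fun k => by
    rw [hb, hc]; split_ifs <;> linarith only [hx1, hy1]
  have hab : ∀ k, a k + b k ≤ x + y := fun k => by
    rw [ha, hb]; split_ifs <;> linarith only [hx1, hy1, hxy, hz1]
  -- total masses and first moments (exact)
  have hsa : ∑ k, a k = 2 * x + z := by
    simp only [ha]
    rw [kitPlateau_sum_univ_three hJ]
    ring
  have hsb : ∑ k, b k = x + y := by
    simp only [hb]
    rw [kitPlateau_sum_univ_three hJ]
    ring
  have hsc : ∑ k, c k = x + y := by
    simp only [hc]
    rw [kitPlateau_sum_univ_three hJ]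
    ring
  have hwa : ∑ k : Fin J, ((J : ℝ) - ((k : ℕ) : ℝ)) * a k = (J : ℝ) * x + ((J : ℝ) - 1) * x + ((J : ℝ) - 2) * z := by
    simp only [ha]
    rw [kitPlateau_wsum_univ_three hJ]
  have hwb : ∑ k : Fin J, ((J : ℝ) - ((k : ℕ) : ℝ)) * b k = (J : ℝ) * y + ((J : ℝ) - 1) * x + ((J : ℝ) - 2) * 0 := by
    simp only [hb]
    rw [kitPlateau_wsum_univ_three hJ]
  have hwc : ∑ k : Fin J, ((J : ℝ) - ((k : ℕ) : ℝ)) * c k = (J : ℝ) * x + ((J : ℝ) - 1) * y + ((J : ℝ) - 2) * 0 := by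
    simp only [hc]
    rw [kitPlateau_wsum_univ_three hJ]
  -- lower bounds for first moments over finsets containing a special index
  have la1 : ∀ S : Finset (Fin J), i1 ∈ S → x ≤ ∑ k ∈ S, ((k : ℕ) : ℝ) * a k := fun S hS => by
    have hl := kitPlateau_single_le_wsum ha0 hS
    rw [hi1, hai1, Nat.cast_one, one_mul] at hl
    exact hl
  have la2 : ∀ S : Finset (Fin J), i2 ∈ S → 2 * z ≤ ∑ k ∈ S, ((k : ℕ) : ℝ) * a k := fun S hS => by
    have hl := kitPlateau_single_le_wsum ha0 hS
    rw [hi2, hai2, Nat.cast_two] at hl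
    exact hl
  have lb1 : ∀ S : Finset (Fin J), i1 ∈ S → x ≤ ∑ k ∈ S, ((k : ℕ) : ℝ) * b k := fun S hS => by
    have hl := kitPlateau_single_le_wsum hb0 hS
    rw [hi1, hbi1, Nat.cast_one, one_mul] at hl
    exact hl
  have lc1 : ∀ S : Finset (Fin J), i1 ∈ S → y ≤ ∑ k ∈ S, ((k : ℕ) : ℝ) * c k := fun S hS => by
    have hl := kitPlateau_single_le_wsum hc0 hS
    rw [hi1, hci1, Nat.cast_one, one_mul] at hl
    exact hl
  -- exact values of the level-set sums entering the DE rows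
  have hPa : ∀ Q : Finset (Fin J), ∑ j ∈ Q, a j =
      (if i0 ∈ Q then x else 0) + (if i1 ∈ Q then x else 0) + (if i2 ∈ Q then z else 0) := fun Q => by
    rw [kitDEPlateau_sum_support_three hi0 hi1 hi2 a ha3 Q, hai0, hai1, hai2]
  have hMa : ∀ Q : Finset (Fin J), ∑ j ∈ Q, (((j : ℕ) : ℝ) + 1) * a j =
      (if i0 ∈ Q then (0 + 1) * x else 0) + (if i1 ∈ Q then (1 + 1) * x else 0) +
        (if i2 ∈ Q then (2 + 1) * z else 0) := fun Q => by
    rw [kitDEPlateau_sum_support_three hi0 hi1 hi2 (fun j => (((j : ℕ) : ℝ) + 1) * a j)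
      (fun k hk => mul_eq_zero_of_right _ (ha3 k hk)) Q, hai0, hai1, hai2, hi0, hi1, hi2, Nat.cast_zero, Nat.cast_one,
      Nat.cast_two]
  have hPb : ∀ Q : Finset (Fin J), ∑ j ∈ Q, b j = (if i0 ∈ Q then y else 0) + (if i1 ∈ Q then x else 0) := fun Q => by
    rw [kitDEPlateau_sum_support_three hi0 hi1 hi2 b hb3 Q, hbi0, hbi1, hbi2, ite_self, add_zero]
  have hMb : ∀ Q : Finset (Fin J), ∑ j ∈ Q, (((j : ℕ) : ℝ) + 1) * b j =
      (if i0 ∈ Q then (0 + 1) * y else 0) + (if i1 ∈ Q then (1 + 1) * x else 0) := fun Q => by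
    rw [kitDEPlateau_sum_support_three hi0 hi1 hi2 (fun j => (((j : ℕ) : ℝ) + 1) * b j)
      (fun k hk => mul_eq_zero_of_right _ (hb3 k hk)) Q, hbi0, hbi1, hbi2, mul_zero, ite_self, add_zero, hi0, hi1,
      Nat.cast_zero, Nat.cast_one]
  have hPc : ∀ Q : Finset (Fin J), ∑ j ∈ Q, c j = (if i0 ∈ Q then x else 0) + (if i1 ∈ Q then y else 0) := fun Q => by
    rw [kitDEPlateau_sum_support_three hi0 hi1 hi2 c hc3 Q, hci0, hci1, hci2, ite_self, add_zero]
  have hMc : ∀ Q : Finset (Fin J), ∑ j ∈ Q, (((j : ℕ) : ℝ) + 1) * c j =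
      (if i0 ∈ Q then (0 + 1) * x else 0) + (if i1 ∈ Q then (1 + 1) * y else 0) := fun Q => by
    rw [kitDEPlateau_sum_support_three hi0 hi1 hi2 (fun j => (((j : ℕ) : ℝ) + 1) * c j)
      (fun k hk => mul_eq_zero_of_right _ (hc3 k hk)) Q, hci0, hci1, hci2, mul_zero, ite_self, add_zero, hi0, hi1,
      Nat.cast_zero, Nat.cast_one]
  -- apply the LP certificate `h` at the witness (`A = 2x + z`, `B = C = x + y`, `D = (2 + s₀)/4`, `db = w`, other deficits and slack `0`)
  suffices key : (2 + s₀) / 4 ≤ Vc + K * 0 by rwa [mul_zero, add_zero] at key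
  refine h a b c (2 * x + z) (x + y) (x + y) ((2 + s₀) / 4) 0 w 0 0 ha0 hb0 hc0 hsa.le hsb.le hsc.le ?_ le_rfl
    zero_le_one ?_ hw0 hw1 ?_ le_rfl le_rfl le_rfl (by norm_num) ?_ ?_ ?_ ?_ ?_ ?_ ?_ ?_ ?_ ?_ ?_ ?_ ?_
  · -- slope of `a` (equality)
    rw [hwa]
    linarith only [hx, hz]
  · -- slope of `b` (equality, deficit `w`)
    rw [hwb]
    linarith only [hx, hy, hw]
  · -- slope of `c` (equality)
    rw [hwc]
    linarith only [hx, hy]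
  · -- radical budget (equality)
    linarith only [hx, hy, hz]
  · -- trivial rows
    linarith only [hx, hy, hz, hs1]
  · linarith only [hx, hy, hz, hs1]
  · linarith only [hx, hy, hs1]
  · -- determinant family: first disjunct, `a k + b k + c k ≤ 2x + y` (equality at `k = 1`)
    intro k _
    exact Or.inl (by linarith only [habc k, hx, hy, hz])
  · -- Fourier family: an admissible index set never contains the index `0`
    intro SU SV SW eU eV eW heU heV heW hU hV hW
    have n0 : ∀ (S : Finset (Fin J)) (e : ℕ), 2 ≤ e → (∀ k ∈ S, e ∣ (k : ℕ) + 1) → i0 ∉ S :=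
      fun S e he hS hm => by
        have hd := hS i0 hm
        rw [hi0] at hd
        have hle := Nat.le_of_dvd (by norm_num) hd
        omega
    have hU' := kitPlateau_add_sum_le_univ ha0 (n0 SU eU heU hU)
    have hV' := kitPlateau_add_sum_le_univ hb0 (n0 SV eV heV hV)
    have hW' := kitPlateau_add_sum_le_univ hc0 (n0 SW eW heW hW)
    rw [hai0, hsa] at hU'
    rw [hbi0, hsb] at hV'
    rw [hci0, hsc] at hW'
    linarith only [hU', hV', hW', hx, hy, hz, hs1]
  · -- geometry-of-numbers family
    intro I J' K'
    have wI := kitPlateau_wsum_nonneg ha0 I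
    have wJ := kitPlateau_wsum_nonneg hb0 J'
    have wK := kitPlateau_wsum_nonneg hc0 K'
    by_cases hI1 : i1 ∈ I
    · exact Or.inr (by linarith only [la1 I hI1, wJ, wK, hx, hy, hz, hs1, hs2])
    by_cases hI2 : i2 ∈ I
    · exact Or.inr (by linarith only [la2 I hI2, wJ, wK, hx, hy, hz, hs1, hs2])
    by_cases hJ1 : i1 ∈ J'
    · exact Or.inr (by linarith only [lb1 J' hJ1, wI, wK, hx, hy, hz, hs1, hs2])
    by_cases hK1 : i1 ∈ K'
    · exact Or.inr (by linarith only [lc1 K' hK1, wI, wJ, hx, hy, hz, hs1, hs2])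
    have sI := kitPlateau_add_add_sum_le_univ ha0 h12 hI1 hI2
    have sJ := kitPlateau_add_sum_le_univ hb0 hJ1
    have sK := kitPlateau_add_sum_le_univ hc0 hK1
    rw [hai1, hai2, hsa] at sI
    rw [hbi1, hsb] at sJ
    rw [hci1, hsc] at sK
    exact Or.inl (by linarith only [sI, sJ, sK, hx, hy, hz, hs1, hs2])
  · -- square-root lattice family, host `a`
    intro H k _
    by_cases hH1 : i1 ∈ H
    · exact Or.inl (by linarith only [la1 H hH1, hx, hy, hz, hs1, hs2])
    by_cases hH2 : i2 ∈ H
    · exact Or.inl (by linarith only [la2 H hH2, hx, hy, hz, hs1, hs2])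
    have sH := kitPlateau_add_add_sum_le_univ ha0 h12 hH1 hH2
    rw [hai1, hai2, hsa] at sH
    exact Or.inr (by linarith only [sH, hbc k, hx, hy, hz, hs1, hs2])
  · -- square-root lattice family, host `b`: the deficit `db = w` makes the first disjunct free
    intro H _ _
    exact Or.inl (by linarith only [kitPlateau_wsum_nonneg hb0 H, hx, hy, hz, hw, hs1, hs2])
  · -- square-root lattice family, host `c`
    intro H k _
    by_cases hH1 : i1 ∈ H
    · exact Or.inl (by linarith only [lc1 H hH1, hx, hy, hz, hs1, hs2])
    have sH := kitPlateau_add_sum_le_univ hc0 hH1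
    rw [hci1, hsc] at sH
    exact Or.inr (by linarith only [sH, hab k, hx, hy, hz, hs1, hs2])
  · -- DE family, host `a` (pivots `b`, `c`): disjunct 1 if `i0 ∈ Q`, else 3 if `i1, i2 ∈ Q` (equality), else 5
    intro j0 j1 hj0 hj1 Q
    have e0 : i0 = j0 := Fin.ext (hi0.trans hj0.symm)
    have e1 : i1 = j1 := Fin.ext (hi1.trans hj1.symm)
    subst e0 e1
    have hP := hPa Q
    have hM := hMa Q
    by_cases q0 : i0 ∈ Q <;> by_cases q1 : i1 ∈ Q <;> by_cases q2 : i2 ∈ Q <;>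
      simp only [q0, q1, q2, if_true, if_false] at hP hM
    · exact Or.inl (by linarith only [hP, hM, hbi0, hci0, hbi1, hci1, hx, hy, hz, hs1, hs2])
    · exact Or.inl (by linarith only [hP, hM, hbi0, hci0, hbi1, hci1, hx, hy, hz, hs1, hs2])
    · exact Or.inl (by linarith only [hP, hM, hbi0, hci0, hbi1, hci1, hx, hy, hz, hs1, hs2])
    · exact Or.inl (by linarith only [hP, hM, hbi0, hci0, hbi1, hci1, hx, hy, hz, hs1, hs2])
    · exact Or.inr (Or.inr (Or.inl (by linarith only [hP, hM, hbi0, hci0, hbi1, hci1, hx, hy, hz, hs1, hs2])))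
    · exact Or.inr (Or.inr (Or.inr (Or.inr (Or.inl
        (by linarith only [hP, hM, hbi0, hci0, hbi1, hci1, hx, hy, hz, hs1, hs2])))))
    · exact Or.inr (Or.inr (Or.inr (Or.inr (Or.inl
        (by linarith only [hP, hM, hbi0, hci0, hbi1, hci1, hx, hy, hz, hs1, hs2])))))
    · exact Or.inr (Or.inr (Or.inr (Or.inr (Or.inl
        (by linarith only [hP, hM, hbi0, hci0, hbi1, hci1, hx, hy, hz, hs1, hs2])))))
  · -- DE family, host `b` (pivots `a`, `c`): always disjunct 1
    intro j0 j1 hj0 hj1 Q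
    have e0 : i0 = j0 := Fin.ext (hi0.trans hj0.symm)
    have e1 : i1 = j1 := Fin.ext (hi1.trans hj1.symm)
    subst e0 e1
    have hP := hPb Q
    have hM := hMb Q
    by_cases q0 : i0 ∈ Q <;> by_cases q1 : i1 ∈ Q <;> simp only [q0, q1, if_true, if_false] at hP hM <;>
      exact Or.inl (by linarith only [hP, hM, hai0, hci0, hai1, hci1, hx, hy, hz, hs1, hs2])
  · -- DE family, host `c` (pivots `a`, `b`): disjunct 1 if `i0 ∈ Q`, else 3 if `i1 ∈ Q`, else 5
    intro j0 j1 hj0 hj1 Q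
    have e0 : i0 = j0 := Fin.ext (hi0.trans hj0.symm)
    have e1 : i1 = j1 := Fin.ext (hi1.trans hj1.symm)
    subst e0 e1
    have hP := hPc Q
    have hM := hMc Q
    by_cases q0 : i0 ∈ Q <;> by_cases q1 : i1 ∈ Q <;> simp only [q0, q1, if_true, if_false] at hP hM
    · exact Or.inl (by linarith only [hP, hM, hai0, hbi0, hai1, hbi1, hx, hy, hz, hs1, hs2])
    · exact Or.inl (by linarith only [hP, hM, hai0, hbi0, hai1, hbi1, hx, hy, hz, hs1, hs2])
    · exact Or.inr (Or.inr (Or.inl (by linarith only [hP, hM, hai0, hbi0, hai1, hbi1, hx, hy, hz, hs1, hs2])))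
    · exact Or.inr (Or.inr (Or.inr (Or.inr (Or.inl
        (by linarith only [hP, hM, hai0, hbi0, hai1, hbi1, hx, hy, hz, hs1, hs2])))))

end Summit.ABC.ABC.Theorems.MazurKaneLaw
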